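import Summits.PneNP.PneNP.Theses.ReslinMediumCover
import Literature.Combinatorics.Expanders.EdgeExpander

/-!
# PneNP / ReslinMediumCover — the expander family EXISTS (support item stmt-PneNP-19699 `ExpanderFamily`)

Route `PneNP/ReslinMediumCover` (draft), support item `ExpanderFamily`: there are `D` and `N₀` such
that for every `N ≥ N₀` some connected graph on `Fin N` of maximum degree `≤ D` has at least `2N`
boundary edges on every MEDIUM vertex set `U` (`⌈N/8⌉ < |U| < N - ⌈N/8⌉`). PROVED with
`D = 514`, `N₀ = 2^18` from the Literature theorem
`Literature.Combinatorics.Expanders.exists_bounded_degree_edgeExpander` (bounded-degree edge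
expanders by Pinsker's counting argument in the slot/permutation model: a good permutation of
`Fin N × Fin 256` plus a Hamiltonian path; constants crude and unoptimised), translating its ordered
cut pairs `(x ∈ U, y ∉ U, x ~ y)` into the route's `edgeCut G U`
(`Literature.Computability.MetaComplexity.edgeCut`, the `Sym2` edges with one endpoint in `U`).

This is the graph-theoretic input that makes the lifted-Tseitin statements of this route and of the
rung files (`…ManyMediumLinesRankBound`: every Res(⊕) refutation of `τ(G,c)∘MAJ₃` over such a graph
has a line of rank `> 2N`) quantify over a NON-EMPTY class of graphs; see
`ReslinMediumCoverLiftedTseitinHard.lean` for the unconditional corollaries.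

References: M. Pinsker, On the complexity of a concentrator (1973); B. Bollobás, The isoperimetric
number of random regular graphs, Eur. J. Combin. 9 (1988); F. Chung, *Spectral Graph Theory* (1997)
§6.1; S. Jukna, *Boolean Function Complexity* (2012), §18.7 (expanders for Tseitin formulas).
-/

namespace Summit.PneNP.PneNP.Theorems

-- `Summit.PneNP.PneNP` repeats a path component by design (summit = sub-problem); silence the linter.
set_option linter.dupNamespace false

open Finset Literature.Computability.MetaComplexity

/-- The ordered cut pairs `(x, y)`, `x ∈ U`, `y ∉ U`, `x ~ y`, inject into the edge cut
`edgeCut G U` (`(x,y) ↦ s(x,y)`): `#{cut pairs} ≤ |edgeCut G U|` (in fact equality). [folklore] -/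
theorem card_cutPairs_le_card_edgeCut {N : ℕ} (G : SimpleGraph (Fin N)) [DecidableRel G.Adj]
    (U : Finset (Fin N)) :
    ((U ×ˢ Uᶜ).filter fun e : Fin N × Fin N => G.Adj e.1 e.2).card ≤ (edgeCut G U).card := by
  classical
  refine card_le_card_of_injOn (fun e => s(e.1, e.2)) ?_ ?_
  · intro e he
    rw [mem_coe, mem_filter, mem_product, mem_compl] at he
    obtain ⟨⟨hx, hy⟩, hadj⟩ := he
    rw [mem_coe, mem_edgeCut]
    exact ⟨(SimpleGraph.mem_edgeSet G).2 hadj, ⟨e.1, hx, Sym2.mem_mk_left _ _⟩,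
      ⟨e.2, hy, Sym2.mem_mk_right _ _⟩⟩
  · intro e he e' he' h
    rw [mem_coe, mem_filter, mem_product, mem_compl] at he he'
    rcases Sym2.eq_iff.1 h with ⟨h1, h2⟩ | ⟨h1, h2⟩
    · exact Prod.ext h1 h2
    · exact absurd (h1 ▸ he.1.1) he'.1.2

/-- **Explicit constants**: for every `N ≥ 2^18` there is a connected graph on `Fin N` of maximum
degree `≤ 514` with at least `2N` boundary edges (`edgeCut`) on every medium vertex set
(`⌈N/8⌉ < |U| < N - ⌈N/8⌉`). From `exists_bounded_degree_edgeExpander` (Pinsker counting, slot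
model) and `card_cutPairs_le_card_edgeCut`. [folklore] -/
theorem exists_medium_edgeExpander (N : ℕ) (hN : 2 ^ 18 ≤ N) :
    ∃ (G : SimpleGraph (Fin N)) (_ : DecidableRel G.Adj), G.Connected ∧ (∀ v, G.degree v ≤ 514) ∧
      ∀ U : Finset (Fin N), (N + 7) / 8 < U.card → U.card + (N + 7) / 8 < N →
        2 * N ≤ (edgeCut G U).card := by
  obtain ⟨G, inst, hconn, hdeg, hcut⟩ :=
    Literature.Combinatorics.Expanders.exists_bounded_degree_edgeExpander N hN
  refine ⟨G, inst, hconn, hdeg, fun U h1 h2 => ?_⟩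
  have h8 : N < 8 * U.card := by omega
  have h8c : N < 8 * Uᶜ.card := by
    rw [Finset.card_compl, Fintype.card_fin]
    omega
  exact (hcut U h8 h8c).trans (card_cutPairs_le_card_edgeCut G U)

/-- **Route support `ExpanderFamily` (stmt-PneNP-19699) PROVED** with `D = 514`, `N₀ = 2^18`:
bounded-degree edge expanders (Pinsker 1973 / Bollobás 1988 type statement, here by counting in the
slot model, `exists_medium_edgeExpander`). The constants are not optimised. [folklore] -/
theorem expanderFamily_proof : Summit.PneNP.PneNP.Theses.ReslinMediumCover.ExpanderFamily :=
  ⟨514, 2 ^ 18, fun N hN => exists_medium_edgeExpander N hN⟩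

end Summit.PneNP.PneNP.Theorems
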